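import Literature.Analysis.SpecialFunctions.DigammaGauss
import Mathlib.Analysis.SpecialFunctions.Log.Deriv
import Mathlib.Analysis.Real.Pi.Bounds
import Mathlib.NumberTheory.ZetaValues
import HarnessLib

/-!
# The digamma function on the line `Re s = 1/4`: series, monotonicity, certified bounds

Trunk T-ANALYSIS support (`Literature/Analysis/SpecialFunctions`), consumed by the certified
proof of Weil positivity at the archimedean place (Yoshida 1992, Thm. 1;
`Literature/NumberTheory/LFunctions/WeilArchimedeanPositivity*.lean`), whose archimedean weight
is `t ↦ Re ψ(1/4 + it/2)` (`Literature.NumberTheory.LFunctions.weilArchQuadratic`).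

From the series of Andrews–Askey–Roy, Thm. 1.2.5 (1.2.13) (`Literature.Analysis.SpecialFunctions.Complex.hasSum_one_div_sub_one_div_digamma`
in `DigammaGauss`) at `w = 1/4 + it/2` and at `w = 1/4` one gets, with `l_m = 2m + 1/2`,

  `Re ψ(1/4 + it/2) − ψ(1/4) = Σ_{m ≥ 0} 2t² / (l_m (l_m² + t²))`     (`hasSum_digammaTerm`),

a series of non-negative terms, each even and increasing in `|t|`. This is the form in which
Yoshida (1992, §6, p. 309: "`ψ'(s) = Σ (n+s)^{-2}` ... `Re ψ(σ + it)` is increasing in `t ≥ 0`")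
uses the weight. Consequences proved here, all elementary from the series:

* `reDigammaQuarter_even`, `reDigammaQuarter_mono` (monotone in `|t|`),
  `reDigammaQuarter_sub_le` (growth `≤ 17 t²`);
* finite partial sums are lower bounds (`sum_digammaTerm_le`), and the *cell inequalities*
  `digammaTerm_sub_ge_lin`, `digammaTerm_sub_ge_poly` (pure algebra:
  `f_l(t) − f_l(u) = 2l(t²−u²)/((l²+t²)(l²+u²))` and `1/(1+x) ≥ Σ_{k<2r} (−x)^k`), giving certified
  linear / polynomial minorants of the weight on an interval `[u, v]` from finitely many rational
  operations (`reDigammaQuarter_sub_ge_sum_lin`, `reDigammaQuarter_sub_ge_sum_poly`);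
* the real Stirling-type lower bound `log x − 1/(2x) − 1/(12x²) ≤ ψ(x)` for `x > 0`
  (`Real.log_sub_le_re_digamma`; the classical first-order Stirling bound — the sign of the
  Euler–Maclaurin remainder, cf. Alzer, Math. Comp. 66 (1997) — proved here from the elementary
  inequality `digammaStirlingGap_nonneg` and Gauss's limit formula), whence the certified decimal
  bounds `re_digamma_one_quarter_ge` (`ψ(1/4) ≥ −4.22745354`; Gauss: `ψ(1/4) = −γ − π/2 − 3 log 2
  = −4.2274535333…`) and `Real.log_pi_le` (`log π ≤ 1.1447299`).

## References

* G. E. Andrews, R. Askey, R. Roy, *Special Functions*, CUP 1999, Thm. 1.2.5 (1.2.13).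
* H. Yoshida, *On Hermitian forms attached to zeta functions*, Adv. Stud. Pure Math. 21 (1992),
  281–325, §6.
* H. Alzer, *On some inequalities for the gamma and psi functions*, Math. Comp. 66 (1997),
  373–389 (two-sided Stirling-type bounds for `ψ`; background only, not cited by tag).
-/

noncomputable section

open Complex Filter Topology Set Finset
open scoped Real

namespace Literature.Analysis.SpecialFunctions

/-! ### The series on the line `Re s = 1/4` -/

/-- The archimedean weight of the explicit formula for `ζ` on the critical line:
`t ↦ Re ψ(1/4 + it/2)` (`ψ = Γ'/Γ`; Yoshida 1992 (2.1), `Literature.NumberTheory.LFunctions.weilArchQuadratic`). [cite: Yoshida1992, §2 eq. (2.1)] -/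
def reDigammaQuarter (t : ℝ) : ℝ :=
  (Complex.digamma (1 / 4 + t / 2 * I)).re

/-- Yoshida's abscissae `l_m = 2m + 1/2` (`= 2(m + 1/4)`). [cite: Yoshida1992, §6] -/
def digammaNode (m : ℕ) : ℝ :=
  2 * m + 1 / 2

/-- The term `f_l(t) = 2t²/(l(l² + t²))` of the vertical series. [folklore] -/
def digammaTerm (l t : ℝ) : ℝ :=
  2 * t ^ 2 / (l * (l ^ 2 + t ^ 2))

/-- `l_m > 0`. [folklore] -/
lemma digammaNode_pos (m : ℕ) : 0 < digammaNode m := by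
  unfold digammaNode; positivity

/-- `l_m ≥ 1/2`. [folklore] -/
lemma one_half_le_digammaNode (m : ℕ) : 1 / 2 ≤ digammaNode m := by
  unfold digammaNode
  have : (0 : ℝ) ≤ m := Nat.cast_nonneg m
  linarith

/-- `f_l(t) ≥ 0` for `l > 0`. [folklore] -/
lemma digammaTerm_nonneg {l : ℝ} (hl : 0 < l) (t : ℝ) : 0 ≤ digammaTerm l t := by
  unfold digammaTerm; positivity

/-- `f_l(0) = 0`. [folklore] -/
lemma digammaTerm_zero (l : ℝ) : digammaTerm l 0 = 0 := by
  simp [digammaTerm]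

/-- `f_l` is even. [folklore] -/
lemma digammaTerm_neg (l t : ℝ) : digammaTerm l (-t) = digammaTerm l t := by
  simp [digammaTerm]

/-- `f_l(t) = 2/l − 2l/(l² + t²)`. [folklore] -/
lemma digammaTerm_eq {l : ℝ} (hl : 0 < l) (t : ℝ) :
    digammaTerm l t = 2 / l - 2 * l / (l ^ 2 + t ^ 2) := by
  unfold digammaTerm
  have h1 : 0 < l ^ 2 + t ^ 2 := by positivity
  field_simp
  ring

/-- `f_l(t) ≤ 2t²/l³`. [folklore] -/
lemma digammaTerm_le {l : ℝ} (hl : 0 < l) (t : ℝ) : digammaTerm l t ≤ 2 * t ^ 2 / l ^ 3 := by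
  unfold digammaTerm
  have h3 : 0 < l ^ 3 := by positivity
  rw [div_le_div_iff₀ (by positivity) h3]
  have : l ^ 3 ≤ l * (l ^ 2 + t ^ 2) := by nlinarith [sq_nonneg t]
  nlinarith [sq_nonneg t]

/-- The increment identity `f_l(t) − f_l(u) = 2l(t² − u²)/((l² + t²)(l² + u²))`. [folklore] -/
lemma digammaTerm_sub {l : ℝ} (hl : 0 < l) (t u : ℝ) :
    digammaTerm l t - digammaTerm l u =
      2 * l * (t ^ 2 - u ^ 2) / ((l ^ 2 + t ^ 2) * (l ^ 2 + u ^ 2)) := by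
  rw [digammaTerm_eq hl, digammaTerm_eq hl]
  have h1 : 0 < l ^ 2 + t ^ 2 := by positivity
  have h2 : 0 < l ^ 2 + u ^ 2 := by positivity
  field_simp
  ring

/-- `f_l` is increasing in `|t|`. [folklore] -/
lemma digammaTerm_mono {l : ℝ} (hl : 0 < l) {t u : ℝ} (h : |u| ≤ |t|) :
    digammaTerm l u ≤ digammaTerm l t := by
  have hsq : u ^ 2 ≤ t ^ 2 := by simpa only [sq_abs] using pow_le_pow_left₀ (abs_nonneg u) h 2
  rw [← sub_nonneg, digammaTerm_sub hl]
  exact div_nonneg (by nlinarith) (by positivity)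

/-- Real part of `1/(1/4 + k + it/2)`. [folklore] -/
lemma re_one_div_quarter_add (t : ℝ) (k : ℕ) :
    (1 / ((1 / 4 : ℂ) + t / 2 * I + k)).re =
      ((k : ℝ) + 1 / 4) / (((k : ℝ) + 1 / 4) ^ 2 + (t / 2) ^ 2) := by
  have h := Literature.Analysis.SpecialFunctions.Complex.re_one_div_add_ofReal ((1 / 4 : ℂ) + t / 2 * I) (k : ℝ)
  have hre : ((1 / 4 : ℂ) + t / 2 * I).re = 1 / 4 := by simp
  have him : ((1 / 4 : ℂ) + t / 2 * I).im = t / 2 := by simp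
  rw [hre, him] at h
  have hk : ((k : ℝ) : ℂ) = (k : ℂ) := by norm_cast
  rw [hk] at h
  rw [h]
  congr 1 <;> ring

/-- **The vertical series** (Andrews–Askey–Roy (1.2.13) at `w = 1/4 + it/2` minus the same at
`w = 1/4`): `Σ_{m≥0} 2t²/(l_m(l_m² + t²)) = Re ψ(1/4 + it/2) − ψ(1/4)`, `l_m = 2m + 1/2`
(Yoshida 1992, §6). [cite: AndrewsAskeyRoy1999, Thm 1.2.5 (1.2.13)] -/
theorem hasSum_digammaTerm (t : ℝ) :
    HasSum (fun m : ℕ ↦ digammaTerm (digammaNode m) t)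
      (reDigammaQuarter t - reDigammaQuarter 0) := by
  set w : ℂ := 1 / 4 + t / 2 * I with hw_def
  have hw : 0 < w.re := by simp [hw_def]
  have hw0 : 0 < ((1 / 4 : ℂ) + (0 : ℝ) / 2 * I).re := by simp
  have h1 := Literature.Analysis.SpecialFunctions.Complex.hasSum_one_div_sub_one_div_digamma hw
  have h0 := Literature.Analysis.SpecialFunctions.Complex.hasSum_one_div_sub_one_div_digamma hw0
  have h := (h1.sub h0).mapL Complex.reCLM
  simp only [Complex.reCLM_apply] at h
  have hlim : (digamma w + Real.eulerMascheroniConstant -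
      (digamma (1 / 4 + (0 : ℝ) / 2 * I) + Real.eulerMascheroniConstant)).re =
      reDigammaQuarter t - reDigammaQuarter 0 := by
    simp only [reDigammaQuarter, sub_re, add_re, hw_def]
    push_cast
    ring
  rw [hlim] at h
  refine h.congr_fun fun k ↦ ?_
  symm
  change (1 / ((k : ℂ) + 1) - 1 / (w + k) - (1 / ((k : ℂ) + 1) - 1 / (1 / 4 + (0 : ℝ) / 2 * I + k))).re
    = digammaTerm (digammaNode k) t
  have e1 : (1 / ((k : ℂ) + 1) - 1 / (w + k) -
      (1 / ((k : ℂ) + 1) - 1 / (1 / 4 + (0 : ℝ) / 2 * I + k))) =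
      1 / (1 / 4 + (0 : ℝ) / 2 * I + k) - 1 / (w + k) := by ring
  rw [e1, sub_re, hw_def, re_one_div_quarter_add, re_one_div_quarter_add]
  unfold digammaTerm digammaNode
  have ha : (0 : ℝ) < (k : ℝ) + 1 / 4 := by positivity
  have hb : (0 : ℝ) < ((k : ℝ) + 1 / 4) ^ 2 + (t / 2) ^ 2 := by positivity
  field_simp
  ring

/-- `Re ψ(1/4 + i·0/2) = Re ψ(1/4)`. [folklore] -/
lemma reDigammaQuarter_zero : reDigammaQuarter 0 = (Complex.digamma (1 / 4)).re := by
  simp [reDigammaQuarter]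

/-- Summability of the vertical series. [folklore] -/
lemma summable_digammaTerm (t : ℝ) : Summable fun m : ℕ ↦ digammaTerm (digammaNode m) t :=
  (hasSum_digammaTerm t).summable

/-- `tsum` form of `hasSum_digammaTerm`. [folklore] -/
lemma tsum_digammaTerm (t : ℝ) :
    ∑' m : ℕ, digammaTerm (digammaNode m) t = reDigammaQuarter t - reDigammaQuarter 0 :=
  (hasSum_digammaTerm t).tsum_eq

/-! ### Evenness, monotonicity, growth -/

/-- `Re ψ(1/4 + it/2)` is even in `t`. [cite: Yoshida1992, §6] -/
theorem reDigammaQuarter_even (t : ℝ) : reDigammaQuarter (-t) = reDigammaQuarter t := by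
  have h := tsum_digammaTerm (-t)
  simp only [digammaTerm_neg] at h
  rw [tsum_digammaTerm t] at h
  linarith

/-- `Re ψ(1/4 + it/2)` is increasing in `|t|` (Yoshida 1992, §6: "`Re ψ(σ + it)` is monotone
increasing in `t ≥ 0`", from `ψ'(s) = Σ (n+s)⁻²`). [cite: Yoshida1992, §6 (p. 309)] -/
theorem reDigammaQuarter_mono {t u : ℝ} (h : |u| ≤ |t|) :
    reDigammaQuarter u ≤ reDigammaQuarter t := by
  have := (summable_digammaTerm u).tsum_le_tsum (fun m ↦ digammaTerm_mono (digammaNode_pos m) h)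
    (summable_digammaTerm t)
  rw [tsum_digammaTerm, tsum_digammaTerm] at this
  linarith

/-- `ψ(1/4) ≤ Re ψ(1/4 + it/2)`. [folklore] -/
theorem reDigammaQuarter_zero_le (t : ℝ) : reDigammaQuarter 0 ≤ reDigammaQuarter t :=
  reDigammaQuarter_mono (by simp)

/-- `Σ_{m ≥ 0} 1/(m+1)² = π²/6` (Mathlib's `hasSum_zeta_two`, reindexed). [folklore] -/
lemma hasSum_one_div_nat_add_one_sq :
    HasSum (fun m : ℕ ↦ (1 : ℝ) / ((m : ℝ) + 1) ^ 2) (π ^ 2 / 6) := by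
  have h := (hasSum_nat_add_iff' (f := fun n : ℕ ↦ (1 : ℝ) / (n : ℝ) ^ 2) 1).2 hasSum_zeta_two
  simp only [Finset.range_one, Finset.sum_singleton, Nat.cast_zero, ne_eq, OfNat.ofNat_ne_zero,
    not_false_eq_true, zero_pow, div_zero, sub_zero, Nat.cast_add, Nat.cast_one] at h
  exact h

/-- Termwise bound `2/l_m³ ≤ 16/(m+1)²`. [folklore] -/
lemma two_div_digammaNode_cube_le (m : ℕ) :
    2 / digammaNode m ^ 3 ≤ 16 * (1 / ((m : ℝ) + 1) ^ 2) := by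
  unfold digammaNode
  have hm : (0 : ℝ) ≤ m := Nat.cast_nonneg m
  rw [mul_one_div, div_le_div_iff₀ (by positivity) (by positivity)]
  nlinarith [sq_nonneg (m : ℝ), mul_nonneg hm (sq_nonneg (m : ℝ)),
    mul_nonneg hm (mul_nonneg hm (sq_nonneg (m : ℝ)))]

/-- Growth: `Re ψ(1/4 + it/2) − ψ(1/4) ≤ 27 t²` (termwise `f_l(t) ≤ 2t²/l³ ≤ 16t²/(m+1)²` and
`16 π²/6 ≤ 27`). [folklore] -/
theorem reDigammaQuarter_sub_le (t : ℝ) :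
    reDigammaQuarter t - reDigammaQuarter 0 ≤ 27 * t ^ 2 := by
  have hS := (hasSum_one_div_nat_add_one_sq.mul_left (16 * t ^ 2))
  have h := hasSum_le (f := fun m : ℕ ↦ digammaTerm (digammaNode m) t)
    (g := fun m : ℕ ↦ 16 * t ^ 2 * (1 / ((m : ℝ) + 1) ^ 2)) (fun m ↦ ?_) (hasSum_digammaTerm t) hS
  · have hpi : π ^ 2 / 6 ≤ 10 / 6 := by
      have := Real.pi_lt_d2
      have h0 := Real.pi_pos.le
      exact div_le_div_of_nonneg_right (by nlinarith) (by norm_num)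
    nlinarith [sq_nonneg t]
  · calc digammaTerm (digammaNode m) t ≤ 2 * t ^ 2 / digammaNode m ^ 3 :=
          digammaTerm_le (digammaNode_pos m) t
      _ = t ^ 2 * (2 / digammaNode m ^ 3) := by ring
      _ ≤ t ^ 2 * (16 * (1 / ((m : ℝ) + 1) ^ 2)) :=
          mul_le_mul_of_nonneg_left (two_div_digammaNode_cube_le m) (sq_nonneg t)
      _ = 16 * t ^ 2 * (1 / ((m : ℝ) + 1) ^ 2) := by ring

/-- Two-sided control: `|Re ψ(1/4 + it/2)| ≤ |ψ(1/4)| + 27 t²`. [folklore] -/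
theorem abs_reDigammaQuarter_le (t : ℝ) :
    |reDigammaQuarter t| ≤ |reDigammaQuarter 0| + 27 * t ^ 2 := by
  have h1 := reDigammaQuarter_sub_le t
  have h2 := reDigammaQuarter_zero_le t
  rw [abs_le]
  constructor
  · nlinarith [neg_abs_le (reDigammaQuarter 0), sq_nonneg t]
  · nlinarith [le_abs_self (reDigammaQuarter 0), sq_nonneg t]

/-! ### Partial sums and cell inequalities -/

/-- Finite partial sums are lower bounds: `ψ(1/4) + Σ_{m<M} f_{l_m}(t) ≤ Re ψ(1/4 + it/2)`. [folklore] -/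
theorem sum_digammaTerm_le (M : ℕ) (t : ℝ) :
    reDigammaQuarter 0 + ∑ m ∈ Finset.range M, digammaTerm (digammaNode m) t ≤
      reDigammaQuarter t := by
  have := sum_le_hasSum (Finset.range M) (fun m _ ↦ digammaTerm_nonneg (digammaNode_pos m) t)
    (hasSum_digammaTerm t)
  linarith

/-- The series of increments: for `|u| ≤ |t|`,
`Σ_m (f_{l_m}(t) − f_{l_m}(u)) = Re ψ(1/4 + it/2) − Re ψ(1/4 + iu/2)` with non-negative terms, so
every finite family of termwise lower bounds sums to a lower bound. [folklore] -/
theorem reDigammaQuarter_sub_ge_sum {t u : ℝ} (h : |u| ≤ |t|) (M : ℕ) {b : ℕ → ℝ}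
    (hb : ∀ m < M, b m ≤ digammaTerm (digammaNode m) t - digammaTerm (digammaNode m) u) :
    ∑ m ∈ Finset.range M, b m ≤ reDigammaQuarter t - reDigammaQuarter u := by
  have hsub := (hasSum_digammaTerm t).sub (hasSum_digammaTerm u)
  have hnn : ∀ m, 0 ≤ digammaTerm (digammaNode m) t - digammaTerm (digammaNode m) u := fun m ↦
    sub_nonneg.2 (digammaTerm_mono (digammaNode_pos m) h)
  have h1 := sum_le_hasSum (Finset.range M) (fun m _ ↦ hnn m) hsub
  have h2 : ∑ m ∈ Finset.range M, b m ≤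
      ∑ m ∈ Finset.range M, (digammaTerm (digammaNode m) t - digammaTerm (digammaNode m) u) :=
    Finset.sum_le_sum fun m hm ↦ hb m (Finset.mem_range.1 hm)
  linarith

/-- **Linear cell bound.** For `0 ≤ u ≤ t ≤ v`:
`f_l(t) − f_l(u) ≥ 2l(t² − u²)/((l² + u²)(l² + v²))`. [folklore] -/
theorem digammaTerm_sub_ge_lin {l u t v : ℝ} (hl : 0 < l) (hu : 0 ≤ u) (hut : u ≤ t)
    (htv : t ≤ v) :
    2 * l * (t ^ 2 - u ^ 2) / ((l ^ 2 + u ^ 2) * (l ^ 2 + v ^ 2)) ≤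
      digammaTerm l t - digammaTerm l u := by
  rw [digammaTerm_sub hl]
  have ht : 0 ≤ t := hu.trans hut
  have hsq : u ^ 2 ≤ t ^ 2 := pow_le_pow_left₀ hu hut 2
  have h1 : 0 ≤ 2 * l * (t ^ 2 - u ^ 2) := mul_nonneg (by positivity) (sub_nonneg.2 hsq)
  have h2 : (l ^ 2 + t ^ 2) * (l ^ 2 + u ^ 2) ≤ (l ^ 2 + u ^ 2) * (l ^ 2 + v ^ 2) := by
    have : l ^ 2 + t ^ 2 ≤ l ^ 2 + v ^ 2 := by nlinarith
    nlinarith [sq_nonneg u, sq_nonneg l]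
  exact div_le_div_of_nonneg_left h1 (by positivity) h2

/-- `1/(1 + x) ≥ Σ_{k < 2r} (−x)^k` for `x ≥ 0` (even truncations of the geometric series are
lower bounds). [folklore] -/
lemma geom_even_le_inv_one_add {x : ℝ} (hx : 0 ≤ x) (r : ℕ) :
    ∑ k ∈ Finset.range (2 * r), (-x) ^ k ≤ 1 / (1 + x) := by
  have h1 : 0 < 1 + x := by linarith
  rw [le_div_iff₀ h1]
  have key : (∑ k ∈ Finset.range (2 * r), (-x) ^ k) * (1 + x) = 1 - x ^ (2 * r) := by
    have := geom_sum_mul_neg (-x) (2 * r)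
    rw [sub_neg_eq_add, Even.neg_pow (even_two_mul r)] at this
    linarith [this]
  rw [key]
  linarith [pow_nonneg hx (2 * r)]

/-- **Polynomial cell bound.** For `0 ≤ u`, `u ≤ |t|`... stated for `u² ≤ t²`: with `s = t² − u²`,
`f_l(t) − f_l(u) ≥ Σ_{k<2r} (−1)^k · 2l · s^{k+1} / (l² + u²)^{k+2}`
(from the increment identity and `1/(1+x) ≥ Σ_{k<2r}(−x)^k` at `x = s/(l² + u²)`). [folklore] -/
theorem digammaTerm_sub_ge_poly {l u t : ℝ} (hl : 0 < l) (hut : u ^ 2 ≤ t ^ 2) (r : ℕ) :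
    ∑ k ∈ Finset.range (2 * r),
        (-1) ^ k * (2 * l) * (t ^ 2 - u ^ 2) ^ (k + 1) / (l ^ 2 + u ^ 2) ^ (k + 2) ≤
      digammaTerm l t - digammaTerm l u := by
  rw [digammaTerm_sub hl]
  set s := t ^ 2 - u ^ 2 with hs
  have hs0 : 0 ≤ s := by rw [hs]; linarith
  have hA : 0 < l ^ 2 + u ^ 2 := by positivity
  set x := s / (l ^ 2 + u ^ 2) with hx
  have hx0 : 0 ≤ x := div_nonneg hs0 hA.le
  have hgeom := geom_even_le_inv_one_add hx0 r
  -- rewrite both sides in terms of x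
  have hlt : l ^ 2 + t ^ 2 = (l ^ 2 + u ^ 2) * (1 + x) := by
    rw [hx]; field_simp; rw [hs]; ring
  have hterm : ∀ k, (-1 : ℝ) ^ k * (2 * l) * s ^ (k + 1) / (l ^ 2 + u ^ 2) ^ (k + 2) =
      (2 * l * s / (l ^ 2 + u ^ 2) ^ 2) * (-x) ^ k := by
    intro k
    rw [hx]
    conv_rhs => rw [neg_pow, div_pow]
    field_simp
    ring
  rw [Finset.sum_congr rfl fun k _ ↦ hterm k, ← Finset.mul_sum, hlt]
  have hc : 0 ≤ 2 * l * s / (l ^ 2 + u ^ 2) ^ 2 := by positivity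
  calc 2 * l * s / (l ^ 2 + u ^ 2) ^ 2 * ∑ k ∈ Finset.range (2 * r), (-x) ^ k
      ≤ 2 * l * s / (l ^ 2 + u ^ 2) ^ 2 * (1 / (1 + x)) := mul_le_mul_of_nonneg_left hgeom hc
    _ = 2 * l * s / ((l ^ 2 + u ^ 2) * (1 + x) * (l ^ 2 + u ^ 2)) := by
        have : 0 < 1 + x := by linarith
        field_simp

/-- **Linear cell minorant of the weight.** For `0 ≤ u ≤ t ≤ v` and any `M`,
`Re ψ(1/4 + iu/2) + (t² − u²) Σ_{m<M} 2 l_m/((l_m² + u²)(l_m² + v²)) ≤ Re ψ(1/4 + it/2)`. [folklore] -/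
theorem reDigammaQuarter_sub_ge_sum_lin {u t v : ℝ} (hu : 0 ≤ u) (hut : u ≤ t) (htv : t ≤ v)
    (M : ℕ) :
    ∑ m ∈ Finset.range M, 2 * digammaNode m * (t ^ 2 - u ^ 2) /
        ((digammaNode m ^ 2 + u ^ 2) * (digammaNode m ^ 2 + v ^ 2)) ≤
      reDigammaQuarter t - reDigammaQuarter u := by
  refine reDigammaQuarter_sub_ge_sum ?_ M fun m _ ↦
    digammaTerm_sub_ge_lin (digammaNode_pos m) hu hut htv
  rw [abs_of_nonneg hu, abs_of_nonneg (hu.trans hut)]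
  exact hut

/-- **Polynomial cell minorant of the weight.** For `u² ≤ t²`, any `M` and `r`,
`Re ψ(1/4 + iu/2) + Σ_{m<M} Σ_{k<2r} (−1)^k 2 l_m (t²−u²)^{k+1}/(l_m² + u²)^{k+2} ≤ Re ψ(1/4 + it/2)`. [folklore] -/
theorem reDigammaQuarter_sub_ge_sum_poly {u t : ℝ} (hut : u ^ 2 ≤ t ^ 2) (M r : ℕ) :
    ∑ m ∈ Finset.range M, ∑ k ∈ Finset.range (2 * r),
        (-1) ^ k * (2 * digammaNode m) * (t ^ 2 - u ^ 2) ^ (k + 1) /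
          (digammaNode m ^ 2 + u ^ 2) ^ (k + 2) ≤
      reDigammaQuarter t - reDigammaQuarter u := by
  refine reDigammaQuarter_sub_ge_sum ?_ M fun m _ ↦
    digammaTerm_sub_ge_poly (digammaNode_pos m) hut r
  exact sq_le_sq.1 hut

/-! ### The real Stirling-type lower bound for `ψ` -/

/-- The elementary gap `φ(y) = log(1+y) − y/2 − y/(2(1+y)) + y²/12 − y²/(12(1+y)²)`; one has
`g(x) − g(x+1) = φ(1/x)` for `g(x) = ψ(x) − log x + 1/(2x) + 1/(12x²)`. [folklore] -/
def digammaStirlingGap (y : ℝ) : ℝ :=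
  Real.log (1 + y) - y / 2 - y / (2 * (1 + y)) + y ^ 2 / 12 - y ^ 2 / (12 * (1 + y) ^ 2)

/-- `φ(0) = 0`. [folklore] -/
lemma digammaStirlingGap_zero : digammaStirlingGap 0 = 0 := by
  simp [digammaStirlingGap]

/-- `φ'(y) = y⁴/(6(1+y)³)` for `y > -1`. [folklore] -/
lemma hasDerivAt_digammaStirlingGap {y : ℝ} (hy : -1 < y) :
    HasDerivAt digammaStirlingGap (y ^ 4 / (6 * (1 + y) ^ 3)) y := by
  have h1 : (1 : ℝ) + y ≠ 0 := by linarith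
  have hy1 : HasDerivAt (fun y : ℝ ↦ 1 + y) 1 y := (hasDerivAt_id y).const_add 1
  have hlog : HasDerivAt (fun y : ℝ ↦ Real.log (1 + y)) (1 / (1 + y)) y := by
    simpa using hy1.log h1
  have hA : HasDerivAt (fun y : ℝ ↦ y / 2) (1 / 2) y := by
    simpa using (hasDerivAt_id y).div_const 2
  have hB : HasDerivAt (fun y : ℝ ↦ y / (2 * (1 + y)))
      ((1 * (2 * (1 + y)) - y * (2 * 1)) / (2 * (1 + y)) ^ 2) y :=
    (hasDerivAt_id y).div (hy1.const_mul 2) (by positivity)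
  have hC : HasDerivAt (fun y : ℝ ↦ y ^ 2 / 12) ((2 : ℕ) * y ^ (2 - 1) / 12) y :=
    (hasDerivAt_pow 2 y).div_const 12
  have hD : HasDerivAt (fun y : ℝ ↦ y ^ 2 / (12 * (1 + y) ^ 2))
      ((((2 : ℕ) * y ^ (2 - 1)) * (12 * (1 + y) ^ 2) -
        y ^ 2 * (12 * ((2 : ℕ) * (1 + y) ^ (2 - 1) * 1))) / (12 * (1 + y) ^ 2) ^ 2) y :=
    (hasDerivAt_pow 2 y).div ((hy1.pow 2).const_mul 12) (by positivity)
  have h : HasDerivAt (fun y : ℝ ↦ Real.log (1 + y) - y / 2 - y / (2 * (1 + y)) + y ^ 2 / 12 -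
      y ^ 2 / (12 * (1 + y) ^ 2)) _ y := (((hlog.fun_sub hA).fun_sub hB).fun_add hC).fun_sub hD
  refine h.congr_deriv ?_
  norm_num
  field_simp
  ring

/-- `φ(y) ≥ 0` for `y ≥ 0` (`φ(0) = 0`, `φ' ≥ 0`). [folklore] -/
lemma digammaStirlingGap_nonneg {y : ℝ} (hy : 0 ≤ y) : 0 ≤ digammaStirlingGap y := by
  have hmono : MonotoneOn digammaStirlingGap (Ici 0) := by
    refine monotoneOn_of_deriv_nonneg (convex_Ici 0) ?_ ?_ ?_
    · exact fun z hz ↦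
        (hasDerivAt_digammaStirlingGap (by linarith [mem_Ici.1 hz])).continuousAt.continuousWithinAt
    · rw [interior_Ici]
      exact fun z hz ↦ (hasDerivAt_digammaStirlingGap (by linarith [mem_Ioi.1 hz])).differentiableAt
        |>.differentiableWithinAt
    · rw [interior_Ici]
      intro z hz
      rw [(hasDerivAt_digammaStirlingGap (by linarith [mem_Ioi.1 hz])).deriv]
      have : 0 < z := mem_Ioi.1 hz
      positivity
  simpa [digammaStirlingGap_zero] using hmono (mem_Ici.2 le_rfl) (mem_Ici.2 hy) hy

/-- The real recurrence `ψ(x+1) = ψ(x) + 1/x` (`Complex.digamma_apply_add_one`), `x > 0`. [folklore] -/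
lemma re_digamma_add_one {x : ℝ} (hx : 0 < x) :
    (Complex.digamma ((x : ℂ) + 1)).re = (Complex.digamma x).re + 1 / x := by
  have hne : ∀ m : ℕ, (x : ℂ) ≠ -m := by
    intro m h
    have := congrArg Complex.re h
    simp at this
    have : (0 : ℝ) ≤ m := Nat.cast_nonneg m
    linarith
  rw [Complex.digamma_apply_add_one _ hne, add_re, ← ofReal_inv, ofReal_re, one_div]

/-- Iterated recurrence: `ψ(x+n) = ψ(x) + Σ_{j<n} 1/(x+j)`, `x > 0`. [folklore] -/
lemma re_digamma_add_nat {x : ℝ} (hx : 0 < x) (n : ℕ) :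
    (Complex.digamma ((x : ℂ) + n)).re =
      (Complex.digamma x).re + ∑ j ∈ Finset.range n, 1 / (x + j) := by
  induction n with
  | zero => simp
  | succ n ih =>
    have hxn : 0 < x + n := by positivity
    have h := re_digamma_add_one hxn
    push_cast at h ⊢
    rw [show (x : ℂ) + (n + 1) = (x + n) + 1 by ring, h, ih, Finset.sum_range_succ]
    ring

/-- `ψ(x+n) − log(x+n) → 0` for real `x > 0` (Gauss's limit formula
`Literature.Analysis.SpecialFunctions.Complex.tendsto_log_sub_sum_inv_digamma` plus the recurrence). [folklore] -/
lemma tendsto_re_digamma_add_nat_sub_log {x : ℝ} (hx : 0 < x) :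
    Tendsto (fun n : ℕ ↦ (Complex.digamma ((x : ℂ) + n)).re - Real.log (x + n)) atTop (𝓝 0) := by
  have hw : 0 < (x : ℂ).re := by simpa using hx
  -- real part of Gauss's formula
  have hG := ((continuous_re.tendsto _).comp (Literature.Analysis.SpecialFunctions.Complex.tendsto_log_sub_sum_inv_digamma hw))
  have hGre : Tendsto (fun n : ℕ ↦ Real.log n - ∑ j ∈ Finset.range (n + 1), 1 / (x + j)) atTop
      (𝓝 (Complex.digamma x).re) := by
    refine hG.congr fun n ↦ ?_
    simp only [Function.comp_apply, sub_re, ofReal_re, re_sum]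
    congr 1
    refine Finset.sum_congr rfl fun j _ ↦ ?_
    rw [show (x : ℂ) + j = ((x + j : ℝ) : ℂ) by push_cast; ring, ← ofReal_one, ← ofReal_div,
      ofReal_re]
  have h1 : Tendsto (fun n : ℕ ↦ (1 : ℝ) / (x + n)) atTop (𝓝 0) :=
    tendsto_const_nhds.div_atTop (tendsto_atTop_add_const_left _ _ tendsto_natCast_atTop_atTop)
  have h2 : Tendsto (fun n : ℕ ↦ Real.log ((n : ℝ) + x) - Real.log n) atTop (𝓝 0) :=
    (Real.tendsto_log_comp_add_sub_log x).comp tendsto_natCast_atTop_atTop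
  have hkey : ∀ n : ℕ, (Complex.digamma ((x : ℂ) + n)).re - Real.log (x + n) =
      ((Complex.digamma x).re - (Real.log n - ∑ j ∈ Finset.range (n + 1), 1 / (x + j)))
        - 1 / (x + n) - (Real.log ((n : ℝ) + x) - Real.log n) := by
    intro n
    rw [re_digamma_add_nat hx, Finset.sum_range_succ, add_comm (n : ℝ) x]
    ring
  simp_rw [hkey]
  have := (((tendsto_const_nhds (x := (Complex.digamma x).re)).sub hGre).sub h1).sub h2
  simp only [sub_self] at this
  exact this

/-- **Stirling-type lower bound for real `ψ`:** `log x − 1/(2x) − 1/(12x²) ≤ ψ(x)` for `x > 0`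
(the classical bound, e.g. Alzer 1997 (2.2); proof: `g(x) = ψ(x) − log x + 1/(2x) + 1/(12x²)`
satisfies `g(x) − g(x+1) = φ(1/x) ≥ 0` and `g(x+n) → 0`). [folklore] -/
theorem Real.log_sub_le_re_digamma {x : ℝ} (hx : 0 < x) :
    Real.log x - 1 / (2 * x) - 1 / (12 * x ^ 2) ≤ (Complex.digamma x).re := by
  -- the step `g(y+1) ≤ g(y)` for `g(y) = ψ(y) − log y + 1/(2y) + 1/(12y²)`
  have hstep : ∀ y : ℝ, 0 < y →
      (Complex.digamma (((y + 1 : ℝ)) : ℂ)).re - Real.log (y + 1) + 1 / (2 * (y + 1)) +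
          1 / (12 * (y + 1) ^ 2) ≤
        (Complex.digamma y).re - Real.log y + 1 / (2 * y) + 1 / (12 * y ^ 2) := by
    intro y hy
    have hgap := digammaStirlingGap_nonneg (one_div_nonneg.2 hy.le)
    have hrec := re_digamma_add_one hy
    have hlog : Real.log (y + 1) = Real.log y + Real.log (1 + 1 / y) := by
      rw [← Real.log_mul hy.ne' (by positivity)]
      congr 1; field_simp
    rw [Complex.ofReal_add, Complex.ofReal_one, hrec, hlog]
    unfold digammaStirlingGap at hgap
    have hy1 : (0 : ℝ) < 1 + 1 / y := by positivity
    have e1 : 1 / (2 * (y + 1)) = (1 / y) / (2 * (1 + 1 / y)) := by field_simp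
    have e2 : 1 / (12 * (y + 1) ^ 2) = (1 / y) ^ 2 / (12 * (1 + 1 / y) ^ 2) := by
      field_simp
    rw [e1, e2]
    have e3 : 1 / (2 * y) = (1 / y) / 2 := by ring
    have e4 : 1 / (12 * y ^ 2) = (1 / y) ^ 2 / 12 := by ring
    rw [e3, e4]
    linarith
  -- iterate: `g(x+n) ≤ g(x)`
  have hiter : ∀ n : ℕ,
      (Complex.digamma (((x + n : ℝ)) : ℂ)).re - Real.log (x + n) + 1 / (2 * (x + n)) +
          1 / (12 * (x + n) ^ 2) ≤
        (Complex.digamma x).re - Real.log x + 1 / (2 * x) + 1 / (12 * x ^ 2) := by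
    intro n
    induction n with
    | zero => simp
    | succ n ih =>
      have h := hstep (x + n) (by positivity)
      push_cast at h ih ⊢
      simp only [← add_assoc] at h ih ⊢
      exact h.trans ih
  -- the limit `g(x+n) → 0`
  have hlim : Tendsto (fun n : ℕ ↦
      (Complex.digamma (((x + n : ℝ)) : ℂ)).re - Real.log (x + n) + 1 / (2 * (x + n)) +
        1 / (12 * (x + n) ^ 2)) atTop (𝓝 0) := by
    have h0 := tendsto_re_digamma_add_nat_sub_log hx
    have hxn : Tendsto (fun n : ℕ ↦ x + n) atTop atTop :=
      tendsto_atTop_add_const_left _ _ tendsto_natCast_atTop_atTop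
    have h1 : Tendsto (fun n : ℕ ↦ (1 : ℝ) / (2 * (x + n))) atTop (𝓝 0) :=
      tendsto_const_nhds.div_atTop (hxn.const_mul_atTop two_pos)
    have h2 : Tendsto (fun n : ℕ ↦ (1 : ℝ) / (12 * (x + n) ^ 2)) atTop (𝓝 0) := by
      refine tendsto_const_nhds.div_atTop (Tendsto.const_mul_atTop (by norm_num) ?_)
      exact (tendsto_pow_atTop two_ne_zero).comp hxn
    have := (h0.add h1).add h2
    simp only [add_zero] at this
    refine this.congr fun n ↦ ?_
    push_cast
    ring
  have h := le_of_tendsto' hlim hiter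
  linarith

/-! ### Certified decimal bounds -/

/-- `log(1 + 1/256) ≥ 1/256 − 1/(2·256²) + 1/(3·256³) − (1/256)⁴/(255/256)`
(`Real.abs_log_sub_add_sum_range_le`). [folklore] -/
lemma log_one_add_inv_256_ge :
    (1 / 256 - 1 / (2 * 256 ^ 2) + 1 / (3 * 256 ^ 3) - (1 / 256) ^ 4 / (255 / 256) : ℝ) ≤
      Real.log (1 + 1 / 256) := by
  have h := Real.abs_log_sub_add_sum_range_le (x := -(1 / 256 : ℝ))
    (by rw [abs_neg, abs_of_pos (by norm_num)]; norm_num) 3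
  rw [abs_le] at h
  have h1 := h.1
  simp only [Finset.sum_range_succ, Finset.sum_range_zero, sub_neg_eq_add] at h1
  norm_num [abs_of_pos] at h1 ⊢
  linarith

/-- `log(257/4) ≥ 4.162781722` (`= 6 log 2 + log(1 + 1/256) = 4.1627817237…`). [folklore] -/
lemma log_257_div_4_ge : (4.162781722 : ℝ) ≤ Real.log (257 / 4) := by
  have h2 := Real.log_two_gt_d9
  have h3 := log_one_add_inv_256_ge
  have : Real.log (257 / 4) = 6 * Real.log 2 + Real.log (1 + 1 / 256) := by
    rw [show (257 / 4 : ℝ) = 2 ^ 6 * (1 + 1 / 256) by norm_num, Real.log_mul (by norm_num)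
      (by norm_num), Real.log_pow]
    push_cast
    ring
  rw [this]
  norm_num at h3 ⊢
  linarith

/-- The rational number `Σ_{j<64} 1/(1/4 + j)`. [folklore] -/
lemma sum_range_64_one_div_quarter_add :
    ∑ j ∈ Finset.range 64, (1 : ℝ) / (1 / 4 + j) ≤ 8.3824329695 := by
  have : ∑ j ∈ Finset.range 64, (1 : ℝ) / (1 / 4 + j) =
      ((∑ j ∈ Finset.range 64, (1 : ℚ) / (1 / 4 + j) : ℚ) : ℝ) := by
    push_cast
    rfl
  rw [this, show (8.3824329695 : ℝ) = ((8.3824329695 : ℚ) : ℝ) by norm_cast]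
  exact_mod_cast (by decide +kernel : ∑ j ∈ Finset.range 64, (1 : ℚ) / (1 / 4 + j) ≤ 8.3824329695)

/-- **`ψ(1/4) ≥ −4.22745354`** (Gauss: `ψ(1/4) = −γ − π/2 − 3 log 2 = −4.2274535333…`), from
the Stirling lower bound at `x = 1/4 + 64` and the recurrence. [folklore] -/
theorem re_digamma_one_quarter_ge : (-4.22745354 : ℝ) ≤ (Complex.digamma (1 / 4)).re := by
  have hq : (0 : ℝ) < 1 / 4 := by norm_num
  have hrec := re_digamma_add_nat hq 64
  have hst := Real.log_sub_le_re_digamma (x := 1 / 4 + 64) (by norm_num)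
  have hcast : (((1 / 4 : ℝ) : ℂ) + (64 : ℕ)) = (((1 / 4 + 64 : ℝ)) : ℂ) := by push_cast; ring
  rw [hcast] at hrec
  have h14 : ((1 / 4 : ℝ) : ℂ) = 1 / 4 := by push_cast; ring
  rw [h14] at hrec
  have hsum := sum_range_64_one_div_quarter_add
  have hlog := log_257_div_4_ge
  rw [show (1 / 4 + 64 : ℝ) = 257 / 4 by norm_num] at hst hrec
  norm_num at hst hrec ⊢
  linarith

/-- **`log π ≤ 1.1447299`** (`log π = 1.14472988…`; from `π < 3.14159265358979323847`,
`log 2 < 0.6931471808` and the series bound for `log(1 − x)`, `x = 1 − π₊/4`). [folklore] -/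
theorem Real.log_pi_le : Real.log π ≤ 1.1447299 := by
  have hpi := Real.pi_lt_d20
  have h2 := Real.log_two_lt_d9
  set q : ℝ := 3.14159265358979323847 with hq
  have hq4 : Real.log q = 2 * Real.log 2 + Real.log (1 - (1 - q / 4)) := by
    rw [show (1 - (1 - q / 4)) = q / 4 by ring, Real.log_div (by norm_num [hq]) (by norm_num),
      show (4 : ℝ) = 2 ^ 2 by norm_num, Real.log_pow]
    push_cast; ring
  have hle : Real.log π ≤ Real.log q := Real.log_le_log Real.pi_pos hpi.le
  have hx : |(1 - q / 4 : ℝ)| < 1 := by rw [hq]; norm_num [abs_of_pos]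
  have hser := Real.abs_log_sub_add_sum_range_le hx 12
  rw [abs_le] at hser
  have hs2 := hser.2
  simp only [Finset.sum_range_succ, Finset.sum_range_zero] at hs2
  rw [hq] at hs2 hq4
  norm_num [abs_of_pos] at hs2 hq4
  rw [hq] at hle
  linarith

/-- The constant of the archimedean weight: `ψ(1/4) − log π ≥ −5.37218344`
(`= −5.3721834192…`). [folklore] -/
theorem re_digamma_one_quarter_sub_log_pi_ge :
    (-5.37218344 : ℝ) ≤ (Complex.digamma (1 / 4)).re - Real.log π := by
  have h1 := re_digamma_one_quarter_ge
  have h2 := Real.log_pi_le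
  linarith

/-- Continuity of `t ↦ Re ψ(1/4 + it/2)`: the vertical series converges uniformly on every
`[-R, R]` (termwise `f_{l_m}(t) ≤ 16 R²/(m+1)²`). [folklore] -/
theorem continuous_reDigammaQuarter : Continuous reDigammaQuarter := by
  have key : reDigammaQuarter =
      fun t ↦ reDigammaQuarter 0 + ∑' m : ℕ, digammaTerm (digammaNode m) t := by
    funext t
    rw [tsum_digammaTerm]
    ring
  refine continuous_iff_continuousAt.2 fun t₀ ↦ ?_
  set R : ℝ := |t₀| + 1 with hR
  have hS : ContinuousOn (fun t ↦ ∑' m : ℕ, digammaTerm (digammaNode m) t) (Set.Icc (-R) R) := by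
    refine continuousOn_tsum (u := fun m : ℕ ↦ 16 * R ^ 2 * (1 / ((m : ℝ) + 1) ^ 2))
      (fun m ↦ ?_) (hasSum_one_div_nat_add_one_sq.summable.mul_left _) fun m t ht ↦ ?_
    · have hl := digammaNode_pos m
      refine Continuous.continuousOn ?_
      unfold digammaTerm
      refine Continuous.div (by fun_prop) (by fun_prop) fun t ↦ ?_
      have : 0 < digammaNode m * (digammaNode m ^ 2 + t ^ 2) := by positivity
      exact this.ne'
    · rw [Real.norm_of_nonneg (digammaTerm_nonneg (digammaNode_pos m) t)]
      have h1 := digammaTerm_le (digammaNode_pos m) t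
      have h2 := two_div_digammaNode_cube_le m
      have habs : |t| ≤ R := abs_le.2 ⟨ht.1, ht.2⟩
      have ht2 : t ^ 2 ≤ R ^ 2 := by
        rw [← sq_abs t]
        exact pow_le_pow_left₀ (abs_nonneg t) habs 2
      have h3 : 0 ≤ 2 / digammaNode m ^ 3 := by
        have := digammaNode_pos m; positivity
      calc digammaTerm (digammaNode m) t ≤ 2 * t ^ 2 / digammaNode m ^ 3 := h1
        _ = t ^ 2 * (2 / digammaNode m ^ 3) := by ring
        _ ≤ R ^ 2 * (16 * (1 / ((m : ℝ) + 1) ^ 2)) :=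
            mul_le_mul ht2 h2 h3 (sq_nonneg R)
        _ = 16 * R ^ 2 * (1 / ((m : ℝ) + 1) ^ 2) := by ring
  have hmem : Set.Icc (-R) R ∈ 𝓝 t₀ :=
    Icc_mem_nhds (by rw [hR]; linarith [neg_abs_le t₀]) (by rw [hR]; linarith [le_abs_self t₀])
  have hct := hS.continuousAt hmem
  rw [key]
  exact continuousAt_const.add hct

/-- Measurability of `t ↦ Re ψ(1/4 + it/2)`. [folklore] -/
theorem measurable_reDigammaQuarter : Measurable reDigammaQuarter :=
  continuous_reDigammaQuarter.measurable

/-! ### A telescoping lower bound for the tail of the vertical series -/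

/-- Telescoping identity `1/(l_m l_{m+1} l_{m+2}) = (1/(l_m l_{m+1}) − 1/(l_{m+1} l_{m+2}))/4`
(`l_{m+2} − l_m = 4`). [folklore] -/
lemma one_div_digammaNode_mul_telescope (m : ℕ) :
    1 / (digammaNode m * digammaNode (m + 1) * digammaNode (m + 2)) =
      (1 / (digammaNode m * digammaNode (m + 1)) -
        1 / (digammaNode (m + 1) * digammaNode (m + 2))) / 4 := by
  unfold digammaNode
  push_cast
  have h0 : (0 : ℝ) < 2 * m + 1 / 2 := by positivity
  have h1 : (0 : ℝ) < 2 * (m + 1) + 1 / 2 := by positivity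
  have h2 : (0 : ℝ) < 2 * (m + 2) + 1 / 2 := by positivity
  field_simp
  ring

/-- Termwise comparison behind the tail bound: for `m = M + i`,
`f_{l_m}(t) ≥ (2t² l_M²/(l_M² + t²)) · 1/(l_m l_{m+1} l_{m+2})`
(`l_m² + t² ≤ l_m²(1 + t²/l_M²)` and `l_m³ ≤ l_m l_{m+1} l_{m+2}`). [folklore] -/
lemma tail_term_le_digammaTerm (M i : ℕ) (t : ℝ) :
    2 * t ^ 2 * digammaNode M ^ 2 / (digammaNode M ^ 2 + t ^ 2) *
        (1 / (digammaNode (M + i) * digammaNode (M + i + 1) * digammaNode (M + i + 2))) ≤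
      digammaTerm (digammaNode (M + i)) t := by
  have hL := digammaNode_pos M
  have hl := digammaNode_pos (M + i)
  have hl1 := digammaNode_pos (M + i + 1)
  have hl2 := digammaNode_pos (M + i + 2)
  have hLl : digammaNode M ≤ digammaNode (M + i) := by
    unfold digammaNode; push_cast; linarith
  have e1 : digammaNode (M + i + 1) = digammaNode (M + i) + 2 := by
    unfold digammaNode; push_cast; ring
  have e2 : digammaNode (M + i + 2) = digammaNode (M + i) + 4 := by
    unfold digammaNode; push_cast; ring
  unfold digammaTerm
  rw [div_mul_div_comm, mul_one, div_le_div_iff₀ (by positivity) (by positivity), e1, e2]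
  set L := digammaNode M
  set l := digammaNode (M + i)
  have ht : 0 ≤ t ^ 2 := sq_nonneg t
  -- `2t²L² · l(l²+t²) ≤ 2t² · (L²+t²) l (l+2)(l+4)`
  have key : L ^ 2 * (l ^ 2 + t ^ 2) ≤ (L ^ 2 + t ^ 2) * ((l + 2) * (l + 4)) := by
    have h1 : l ^ 2 ≤ (l + 2) * (l + 4) := by nlinarith
    have h2 : L ^ 2 ≤ (l + 2) * (l + 4) := by nlinarith
    nlinarith [mul_le_mul_of_nonneg_left h1 (sq_nonneg L), mul_le_mul_of_nonneg_left h2 ht]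
  calc 2 * t ^ 2 * L ^ 2 * (l * (l ^ 2 + t ^ 2))
      = 2 * t ^ 2 * l * (L ^ 2 * (l ^ 2 + t ^ 2)) := by ring
    _ ≤ 2 * t ^ 2 * l * ((L ^ 2 + t ^ 2) * ((l + 2) * (l + 4))) :=
        mul_le_mul_of_nonneg_left key (by positivity)
    _ = 2 * t ^ 2 * ((L ^ 2 + t ^ 2) * (l * (l + 2) * (l + 4))) := by ring

/-- **Tail bound.** The terms dropped by a partial sum are bounded below by a telescoping series:
`ψ(1/4) + Σ_{m<M} f_{l_m}(t) + t² l_M/(2 (l_M² + t²) l_{M+1}) ≤ Re ψ(1/4 + it/2)`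
(`Σ_{m≥M} f_{l_m}(t) ≥ (2t² l_M²/(l_M²+t²)) Σ_{m≥M} 1/(l_m l_{m+1} l_{m+2})
 = (2t² l_M²/(l_M²+t²)) / (4 l_M l_{M+1})`). [folklore] -/
theorem sum_digammaTerm_add_tail_le (M : ℕ) (t : ℝ) :
    reDigammaQuarter 0 + ∑ m ∈ Finset.range M, digammaTerm (digammaNode m) t +
        t ^ 2 * digammaNode M / (2 * (digammaNode M ^ 2 + t ^ 2) * digammaNode (M + 1)) ≤
      reDigammaQuarter t := by
  set f : ℕ → ℝ := fun m ↦ digammaTerm (digammaNode m) t with hf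
  have hS := (hasSum_nat_add_iff' M).2 (hasSum_digammaTerm t)
  set S := reDigammaQuarter t - reDigammaQuarter 0 - ∑ i ∈ Finset.range M, f i with hSdef
  -- the telescoping minorant
  set c : ℝ := 2 * t ^ 2 * digammaNode M ^ 2 / (digammaNode M ^ 2 + t ^ 2) with hc
  set a : ℕ → ℝ := fun i ↦ 1 / (digammaNode (M + i) * digammaNode (M + i + 1)) with ha
  have hc0 : 0 ≤ c := by have := digammaNode_pos M; positivity
  have hpart : ∀ K : ℕ, c * (a 0 - a K) / 4 ≤ S := by
    intro K
    have h1 : ∑ i ∈ Finset.range K, f (i + M) ≤ S :=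
      sum_le_hasSum (Finset.range K) (fun i _ ↦ digammaTerm_nonneg (digammaNode_pos _) t) hS
    have h2 : ∑ i ∈ Finset.range K, c * ((a i - a (i + 1)) / 4) ≤
        ∑ i ∈ Finset.range K, f (i + M) := by
      refine Finset.sum_le_sum fun i _ ↦ ?_
      have h := tail_term_le_digammaTerm M i t
      rw [one_div_digammaNode_mul_telescope] at h
      have e : M + i = i + M := add_comm M i
      rw [ha]
      simp only
      rw [show M + (i + 1) = M + i + 1 from rfl, show M + i + 1 + 1 = M + i + 2 from rfl, ← e]
      exact h
    have h3 : ∑ i ∈ Finset.range K, c * ((a i - a (i + 1)) / 4) = c * (a 0 - a K) / 4 := by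
      rw [← Finset.mul_sum, ← Finset.sum_div, Finset.sum_range_sub', mul_div_assoc]
    linarith
  -- `a K → 0`
  have ha0 : Tendsto a atTop (𝓝 0) := by
    refine squeeze_zero (fun K ↦ ?_) (fun K ↦ ?_) tendsto_one_div_add_atTop_nhds_zero_nat
    · have := digammaNode_pos (M + K); have := digammaNode_pos (M + K + 1)
      rw [ha]; positivity
    · rw [ha]
      have h1 := one_half_le_digammaNode (M + K)
      have h2 : (K : ℝ) + 1 ≤ digammaNode (M + K) * digammaNode (M + K + 1) := by
        have : 2 * ((K : ℝ) + 1) ≤ digammaNode (M + K + 1) := by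
          unfold digammaNode; push_cast; linarith
        nlinarith [digammaNode_pos (M + K + 1)]
      exact one_div_le_one_div_of_le (by positivity) h2
  have hlim : Tendsto (fun K ↦ c * (a 0 - a K) / 4) atTop (𝓝 (c * (a 0 - 0) / 4)) :=
    ((tendsto_const_nhds.sub ha0).const_mul c).div_const 4
  have hle : c * (a 0 - 0) / 4 ≤ S := le_of_tendsto' hlim hpart
  have hval : c * (a 0 - 0) / 4 =
      t ^ 2 * digammaNode M / (2 * (digammaNode M ^ 2 + t ^ 2) * digammaNode (M + 1)) := by
    rw [sub_zero, hc, ha]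
    have h0 := digammaNode_pos M
    have h1 := digammaNode_pos (M + 0 + 1)
    simp only [add_zero]
    field_simp
    ring
  rw [hval, hSdef] at hle
  linarith

end Literature.Analysis.SpecialFunctions
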